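import Mathlib
import HarnessLib
import Summits.SmoothPoincare4.SmoothPoincare4.Theses.OneStabInvertible
import Literature.Topology.FourManifolds.ConnectedSum
import Literature.Topology.FourManifolds.HomotopyS4CompactProofs

/-!
# Birth skeleton (BC3) for crux `InvertibleOfOneStab` (INV) of route OneStabInvertible

Crux (stmt-SmoothPoincare4-18064, fixed, concluded BY NAME below):
`Summit.SmoothPoincare4.SmoothPoincare4.Theses.OneStabInvertible.InvertibleOfOneStab` —
a smooth homotopy 4-sphere `M` with ONE stabilisation `M # (S²×S²) ≅ S²×S²` is a unit of the
Kervaire–Milnor monoid: `S⁴` is a connected sum `M # M'`.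

LINE (transfer to the exposed, `M`-free form; the route header's own reading of INV:
"INV only asks for an EMBEDDING `M ∖ pt ↪ ℝ⁴` of the dual-pair complement `S²×S² ∖ ν(A ∪ G)`",
Kirby Problem 4.33 form).  Unfolding the one-fold stabilisation `P ≅ S²×S²`,
`P = (M ∖ {i₁ 0}) ∪ (S²×S² ∖ {i 0})` glued along Kervaire–Milnor's annulus, the punctured sphere
`M ∖ {i₁ 0}` is diffeomorphic (via `g := φ ∘ jA`) to the open subset
`Y(i, ψ) := S²×S² ∖ ψ (S²×S² ∖ i (ball 0 1))` of `S²×S²`, where `ψ := φ ∘ jB` is a smooth OPEN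
RE-EMBEDDING of the punctured `S²×S²` into `S²×S²` and `S²×S² ∖ i (ball 0 1)` is a closed regular
neighbourhood of the wedge `S² ∨ S²`; so `Y` is the complement of a closed tubular neighbourhood of
the KNOTTED DUAL PAIR `A ∪ G = ψ (S² ∨ S²)`.  INV ⟸

* `stub_dualPairDictionary` (M-sized Lean, provable now: unpack `IsConnectedSum`/`IsOpenGluing`,
  compose with the diffeomorphism `φ`, compute `range jA` from the Kervaire–Milnor relation):
  one stabilisation of `M` ⇒ discs `i₁`, `i`, a smooth open self-re-embedding `ψ` of the punctured
  `S²×S²`, and a smooth embedding `g : M ∖ {i₁ 0} → S²×S²` with `range g = Y(i, ψ)`.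
* `stub_coNeighbourhoodEmbeds` (THE HARD STUB = INV in exposed form, open, SPC4-implied):
  for every smooth disc `i` and smooth open re-embedding `ψ` of `S²×S² ∖ {i 0}` into `S²×S²`,
  every 4-manifold `V` smoothly embedded onto `Y(i, ψ)` smoothly embeds in `ℝ⁴`
  ("the contractible side of the 3-sphere `ψ(i(∂ ball)) = ∂ν(A ∪ G) ⊂ S²×S²` is a Schoenflies ball
  that re-embeds in `S⁴`").  WHY EASIER than INV as typed: the open manifold is no longer an
  abstract `M ∖ pt` but an explicit region of the KNOWN manifold `S²×S²` cut out by a knotted dual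
  pair of embedded spheres with `A · G = 1`, `A² = G² = 0`; embedded-surface and handle tools bite
  on exactly this data (Kirby1989 p.14: `Δ ∪ 2-handles ≅ ♮ S²×B²  ⇒  Δ ⊂ S⁴`, used on the
  Akbulut–Kirby ball; light-bulb isotopy for spheres with duals, Gabai2020 Thm 10.1; Kirby list
  4.33), none of which can be phrased over the bare binders of INV.
* `stub_invertibleOfPuncturedEmbedding` (L-sized Lean, classical, provable now: the regluing
  construction `M' := (S⁴ ∖ σ f (M ∖ i₁ (ball 0 1))) ∪ {★}` with the inverted disc at `★`,
  `σ` = inverse stereographic projection; `f` is first tamed near the puncture by a radial push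
  `M ∖ {p} ≅ M ∖ i₁ (closedBall 0 2⁻¹)`): a CLOSED smooth 4-manifold whose punctured copy
  `M ∖ {p}` smoothly embeds in `ℝ⁴` is invertible, `S⁴ = M # M'` (Kervaire–Milnor 1963 §2;
  FreedmanGompfMorrisonWalker2010 p.3 fn.; the grounder's note "classical but NOT in tree").
  Its hypothesis is typed exactly like SchoenfliesSplit's crux (A) `SchsplitPuncturedEmbeds`
  (`{p}ᶜ` as `Opens`, `Manifold.IsSmoothEmbedding (𝓡 4) (𝓡 4) ∞ f`), so it also serves that route.

Composition `InvertibleOfOneStab_of : InvertibleOfOneStab` uses the three stubs BY NAME and is otherwise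
real (no sorry of its own): dictionary ⇒ exposed stub at
`V := M ∖ {i₁ 0}` ⇒ punctured embedding ⇒ (compactness of `M ≃ₕ S⁴` from the PROVED tree theorem
`compactSpace_of_homotopyEquiv_sphere_four_holds`) regluing ⇒ INV.

Disproof used: none exists yet for this crux (`ledger crux ls stmt-SmoothPoincare4-18064`: no
workfiles, no `Disproof.lean`, 2026-08-17); negatives index for SmoothPoincare4: empty.
Refuter birth vetting (W.lean/A3.lean notes on the item): INV is SPC4-shielded, non-vacuous at
`M = S⁴`; `e : M ≃ₕ S⁴` is redundant given the stabilisation — accordingly no stub uses `e` except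
through compactness in the composition.
-/

open scoped Manifold ContDiff Topology
open Set Literature.Topology.FourManifolds

-- single-conjunct summit: the duplicate `SmoothPoincare4.SmoothPoincare4` is mandated by the layout
set_option linter.dupNamespace false

namespace Summit.SmoothPoincare4.SmoothPoincare4.Cruxes.InvertibleOfOneStab.Birth

/-- Local notation: the model space `ℝ⁴`. -/
local notation "𝔼4" => EuclideanSpace ℝ (Fin 4)
/-- Local notation: the round 2-sphere with its Mathlib manifold structure. -/
local notation "𝕊²" => (Metric.sphere (0 : EuclideanSpace ℝ (Fin 3)) 1)
/-- Local notation: the round 4-sphere with its Mathlib manifold structure. -/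
local notation "𝕊⁴" => (Metric.sphere (0 : EuclideanSpace ℝ (Fin 5)) 1)

/-- **Stub 1 — dual-pair dictionary** (provable now, M-sized).  A one-fold stabilisation
`M # (S²×S²) ≅ S²×S²` of `M` (the hypothesis of INV, verbatim) yields: the disc `i₁ : ℝ⁴ → M` of the
sum, the disc `i : ℝ⁴ → S²×S²`, a smooth OPEN re-embedding `ψ` of the punctured `S²×S² ∖ {i 0}`
into `S²×S²` (`ψ = φ ∘ jB`), and a smooth embedding `g = φ ∘ jA` of the punctured `M ∖ {i₁ 0}` into
`S²×S²` whose range is exactly the co-neighbourhood `S²×S² ∖ ψ (S²×S² ∖ i (ball 0 1))` of the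
knotted dual pair `ψ (S² ∨ S²)` (range computation from Kervaire–Milnor's relation
`i₁ (t • u) ∼ i ((1 - t) • u)`). -/
theorem stub_dualPairDictionary :
    ∀ (M : Type) [TopologicalSpace M] [T2Space M] [SecondCountableTopology M]
      [ChartedSpace 𝔼4 M] [IsManifold (𝓡 4) ∞ M],
      (∃ (P : Type) (_ : TopologicalSpace P) (_ : ChartedSpace 𝔼4 P) (_ : IsManifold (𝓡 4) ∞ P),
          IsConnectedSum (𝓡 4) (𝓡 4) ((𝓡 2).prod (𝓡 2)) M (𝕊² × 𝕊²) P ∧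
            Nonempty (P ≃ₘ⟮𝓡 4, (𝓡 2).prod (𝓡 2)⟯ (𝕊² × 𝕊²))) →
      ∃ (i₁ : 𝔼4 → M) (i : 𝔼4 → 𝕊² × 𝕊²) (ψ : puncture i → 𝕊² × 𝕊²),
        Manifold.IsSmoothEmbedding 𝓘(ℝ, 𝔼4) (𝓡 4) ∞ i₁ ∧
        Manifold.IsSmoothEmbedding 𝓘(ℝ, 𝔼4) ((𝓡 2).prod (𝓡 2)) ∞ i ∧
        Manifold.IsSmoothEmbedding ((𝓡 2).prod (𝓡 2)) ((𝓡 2).prod (𝓡 2)) ∞ ψ ∧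
        IsOpen (range ψ) ∧
        ∃ g : puncture i₁ → 𝕊² × 𝕊²,
          Manifold.IsSmoothEmbedding (𝓡 4) ((𝓡 2).prod (𝓡 2)) ∞ g ∧
          range g = (ψ '' {y | (y : 𝕊² × 𝕊²) ∉ i '' Metric.ball 0 1})ᶜ := by
  sorry

/-- **Stub 2 — the co-neighbourhood of a re-embedded dual pair embeds in `ℝ⁴`** (THE HARD STUB:
INV in exposed, `M`-free form; open, SPC4-implied).  For every smooth disc `i : ℝ⁴ → S²×S²` and
every smooth open re-embedding `ψ : S²×S² ∖ {i 0} → S²×S²`, any smooth 4-manifold `V` smoothly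
embedded onto `S²×S² ∖ ψ (S²×S² ∖ i (ball 0 1))` — the complement of a closed tubular
neighbourhood of the knotted dual pair `A ∪ G = ψ (S² ∨ S²)` — smoothly embeds in `ℝ⁴`
(the contractible side of `∂ν(A ∪ G) ≅ S³ ⊂ S²×S²` re-embeds in `S⁴` as a Schoenflies ball;
Kirby Problem 4.33 form of invertibility). -/
theorem stub_coNeighbourhoodEmbeds :
    ∀ (i : 𝔼4 → 𝕊² × 𝕊²) (ψ : puncture i → 𝕊² × 𝕊²),
      Manifold.IsSmoothEmbedding 𝓘(ℝ, 𝔼4) ((𝓡 2).prod (𝓡 2)) ∞ i →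
      Manifold.IsSmoothEmbedding ((𝓡 2).prod (𝓡 2)) ((𝓡 2).prod (𝓡 2)) ∞ ψ →
      IsOpen (range ψ) →
      ∀ (V : Type) [TopologicalSpace V] [T2Space V] [SecondCountableTopology V]
        [ChartedSpace 𝔼4 V] [IsManifold (𝓡 4) ∞ V] (g : V → 𝕊² × 𝕊²),
        Manifold.IsSmoothEmbedding (𝓡 4) ((𝓡 2).prod (𝓡 2)) ∞ g →
        range g = (ψ '' {y | (y : 𝕊² × 𝕊²) ∉ i '' Metric.ball 0 1})ᶜ →
        ∃ f : V → 𝔼4, Manifold.IsSmoothEmbedding (𝓡 4) (𝓡 4) ∞ f := by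
  sorry

/-- **Stub 3 — punctured embedding ⇒ invertible** (classical regluing, provable now, L-sized).
A closed smooth 4-manifold `M` some punctured copy `M ∖ {p}` of which smoothly embeds in `ℝ⁴` is a
unit of the Kervaire–Milnor monoid: there is a closed smooth `M'` with `S⁴ = M # M'`
(`M' = (S⁴ ∖ σ f (M ∖ disc)) ∪ pt` with the inverted disc; Kervaire–Milnor 1963 §2,
Freedman–Gompf–Morrison–Walker 2010 p.3 fn.).  Hypothesis typed exactly as SchoenfliesSplit's
`SchsplitPuncturedEmbeds` (bare-binder form). -/
theorem stub_invertibleOfPuncturedEmbedding :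
    ∀ (M : Type) [TopologicalSpace M] [T2Space M] [SecondCountableTopology M]
      [ChartedSpace 𝔼4 M] [IsManifold (𝓡 4) ∞ M] [CompactSpace M],
      (∃ (p : M) (f : (⟨{p}ᶜ, isOpen_compl_singleton⟩ : TopologicalSpace.Opens M) → 𝔼4),
          Manifold.IsSmoothEmbedding (𝓡 4) (𝓡 4) ∞ f) →
      ∃ (M' : Type) (_ : TopologicalSpace M') (_ : T2Space M') (_ : SecondCountableTopology M')
        (_ : ChartedSpace 𝔼4 M') (_ : IsManifold (𝓡 4) ∞ M'),
        IsConnectedSum (𝓡 4) (𝓡 4) (𝓡 4) M M' 𝕊⁴ := by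
  sorry

/-- **Composition (kernel-checked; no sorry of its own): the three named stubs give the crux BY NAME.**
Dictionary ⇒ the exposed stub at `V := M ∖ {i₁ 0}` ⇒ a punctured embedding of `M` in `ℝ⁴` ⇒
(compactness of `M ≃ₕ S⁴`, proved tree theorem) regluing ⇒ `S⁴ = M # M'`.  The only `sorry`s this
theorem depends on are the three `stub_*` declarations, each used by name. -/
theorem InvertibleOfOneStab_of :
    Summit.SmoothPoincare4.SmoothPoincare4.Theses.OneStabInvertible.InvertibleOfOneStab := by
  intro M _ _ _ _ _ e hstab
  obtain ⟨i₁, i, ψ, -, hi, hψ, hψo, g, hg, hrange⟩ := stub_dualPairDictionary M hstab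
  obtain ⟨f, hf⟩ := stub_coNeighbourhoodEmbeds i ψ hi hψ hψo (↥(puncture i₁)) g hg hrange
  haveI : CompactSpace M := compactSpace_of_homotopyEquiv_sphere_four_holds M e
  exact stub_invertibleOfPuncturedEmbedding M ⟨i₁ 0, f, hf⟩

end Summit.SmoothPoincare4.SmoothPoincare4.Cruxes.InvertibleOfOneStab.Birth
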